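import Mathlib
import Summits.KontsevichZagierPeriods.Zeta5Search.StairRayFLAG
import Summits.KontsevichZagierPeriods.Zeta5Search.Zeta3LawWindow
import HarnessLib

/-!
# ζ(5) search — DENOM-LAW D1: the flag band's W-law `‖W(n·β)‖_p ≤ 1`, `‖W(n·β + e₇)‖_p ≤ 1` on `21n < p ≤ 22n` (theory-d1 g2's W7) is a THEOREM

HONEST FRAMING: systematic search; no irrationality claim unless certified.  Cell `pub-zeta5`, track «DENOM-LAW» D1, seat `denom-prover-d1`
gen 2.  On the band-60 FLAG ray `b = n·(60; 25,24,22,21,19,18,16)` (direction `(11,24,14,22,17,23,26,19)`; the tree's literal ray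
`bRay [60,25,24,22,21,19,18,16] n` of `StairRayFLAG`) theory-d1 g2 found the band `21n < p ≤ 22n` to be TERMWISE
(`HOME/denom-law/prover-d1/HANDOFF-theory-g2.md` §1: `v_p(W) = v_p(W₇) = 0`, `v_p(V) = v_p(V₇) = −3` at all 269 cells `n ≤ 60`) and typed
the two single-sum statements W7 (`‖W‖_p ≤ 1` for `b` and `b + e₇`) and V7 (`‖V‖_p ≤ p³`) whose product gives the band's Casoratian bound
(`prover-d1/FlagBandV7.lean`; the Casoratian bound itself is the tree's `StairFLAG.cell_a_norm`, by the double-drop bonus).  This file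
discharges W7: it is the instance `law_W = min(1,⌊(d+1)/p⌋) + a_p − N_p = 1 + 4 − 5 = 0` of the PROVED window form of the
ζ(3)-coefficient valuation law (`ClusterValuation.zeta3CoefficientValuationLaw_window`), for `b` (`d = 35n`) and for `b + e₇`
(`d = 35n − 1`, least parameter `16n + 1`; `N_p(b+e₇) ≤ N_p(b)` by `pairFloors_shift_le`).  The bookkeeping: `bMin`, the refund, the four
top partners `22n(−1), 23n(−1), 25n(−1), 26n(−1) ≥ p`, and the pair-floor profile `N_p ≤ 5` on the band (blocks `22n, 23n, 23n, 25n, 26n`).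
V7 stays OBSERVED.  Valuations of explicit rationals; nothing about ζ(5); records in print UNMOVED.
-/

open Finset

namespace Summit.KontsevichZagierPeriods.Zeta5Search.StairFLAG

open Summit.KontsevichZagierPeriods.Zeta5Search.WedgeDictionary (coeffW dOf)
open Summit.KontsevichZagierPeriods.Zeta5Search.CasoratianValuation (InPolytope pairFloors bMin topPartners refundW shift)
open Summit.KontsevichZagierPeriods.Zeta5Search.ClusterValuation (lawW zeta3CoefficientValuationLaw_window padicNorm_le_of_val
  pairFloors_shift_le)
open Summit.KontsevichZagierPeriods.Zeta5Search.StaircaseCells (bRay)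

/-! ## §1 The unshifted vector `b = n·(60; 25,24,22,21,19,18,16)` -/

/-- `bMin b = 16n`. -/
theorem bMin_flag (n : ℕ) : bMin ((bRay [60, 25, 24, 22, 21, 19, 18, 16]) n) = ((n * 16 : ℕ) : ℤ) := by
  unfold bMin
  apply le_antisymm
  · exact Finset.min'_le _ _ (mem_image.2 ⟨6, by simp, by rw [v7]⟩)
  · apply Finset.le_min'
    intro x hx
    obtain ⟨i, hi, rfl⟩ := mem_image.1 hx
    have : i < 7 := mem_range.1 hi
    interval_cases i <;> simp only [Nat.reduceAdd, v1, v2, v3, v4, v5, v6, v7] <;> push_cast <;> omega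

/-- The refund is `1` for `p ≤ 35n + 1` (`d = 35n`). -/
theorem refundW_flag {n p : ℕ} (hp0 : 0 < p) (h : p ≤ 35 * n + 1) : refundW ((bRay [60, 25, 24, 22, 21, 19, 18, 16]) n) p = 1 := by
  unfold refundW
  rw [dOf_ray]
  apply min_eq_left
  rw [Int.le_ediv_iff_mul_le (by exact_mod_cast hp0)]
  push_cast
  have : (p : ℤ) ≤ 35 * n + 1 := by exact_mod_cast h
  linarith

/-- `a_p(b) ≥ 4` on the band: the partners `22n, 23n, 25n, 26n` (and the top block `28n`) reach `p ≤ 22n`. -/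
theorem topPartners_flag_ge {n p : ℕ} (hB : p ≤ 22 * n) : 4 ≤ topPartners ((bRay [60, 25, 24, 22, 21, 19, 18, 16]) n) p := by
  unfold topPartners
  rw [bMin_flag]
  have hsub : ({2, 3, 4, 5, 6} : Finset ℕ) ⊆
      (range 7).filter (fun i => (p : ℤ) ≤ (bRay [60, 25, 24, 22, 21, 19, 18, 16]) n 0 - (bRay [60, 25, 24, 22, 21, 19, 18, 16]) n (i + 1) - ((n * 16 : ℕ) : ℤ)) := by
    intro i hi
    simp only [mem_insert, mem_singleton] at hi
    rw [mem_filter, mem_range]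
    have hp : (p : ℤ) ≤ 22 * n := by exact_mod_cast hB
    rcases hi with rfl | rfl | rfl | rfl | rfl <;> refine ⟨by norm_num, ?_⟩ <;>
      simp only [Nat.reduceAdd, v0, v3, v4, v5, v6, v7] <;> push_cast <;> linarith
  have hc := Finset.card_le_card hsub
  have h5 : ({2, 3, 4, 5, 6} : Finset ℕ).card = 5 := by decide
  have : (if (p : ℤ) ≤ (bRay [60, 25, 24, 22, 21, 19, 18, 16]) n 0 - 2 * ((n * 16 : ℕ) : ℤ) then (1 : ℤ) else 0) ≤ 1 := by split_ifs <;> norm_num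
  omega

/-- `⌊z/p⌋ ≤ 0` when `z < p`, and `≤ 1` when `z < 2p` (`p > 0`). -/
theorem ediv_le_of_lt' {z : ℤ} {p : ℕ} (hp0 : 0 < p) (k : ℤ) (hz : z < (k + 1) * p) : z / (p : ℤ) ≤ k := by
  have hp0' : (0 : ℤ) < p := by exact_mod_cast hp0
  have := Int.ediv_lt_iff_lt_mul hp0' |>.2 (by linarith : z < (k + 1) * (p : ℤ))
  omega

set_option maxHeartbeats 800000 in
/-- `N_p(b) ≤ 5` on the band `21n < p ≤ 22n`: only the blocks `22n, 23n, 23n, 25n, 26n` reach `p`, each once (`26n < 2p`). -/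
theorem pairFloors_flag_le {n p : ℕ} (hp0 : 0 < p) (hA : 21 * n < p) : pairFloors ((bRay [60, 25, 24, 22, 21, 19, 18, 16]) n) p ≤ 5 := by
  have hp0' : (0 : ℤ) < p := by exact_mod_cast hp0
  have hpZ : (21 * n : ℤ) < p := by exact_mod_cast hA
  simp only [pairFloors, sum_range_succ, sum_range_zero, zero_add, Nat.reduceAdd, v0, v1, v2, v3, v4, v5, v6, v7]
  norm_num
  have t12 : ((n : ℤ) * 60 - n * 25 - n * 24) / p ≤ 0 := ediv_le_of_lt' hp0 0 (by linarith)
  have t13 : ((n : ℤ) * 60 - n * 25 - n * 22) / p ≤ 0 := ediv_le_of_lt' hp0 0 (by linarith)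
  have t14 : ((n : ℤ) * 60 - n * 25 - n * 21) / p ≤ 0 := ediv_le_of_lt' hp0 0 (by linarith)
  have t15 : ((n : ℤ) * 60 - n * 25 - n * 19) / p ≤ 0 := ediv_le_of_lt' hp0 0 (by linarith)
  have t16 : ((n : ℤ) * 60 - n * 25 - n * 18) / p ≤ 0 := ediv_le_of_lt' hp0 0 (by linarith)
  have t17 : ((n : ℤ) * 60 - n * 25 - n * 16) / p ≤ 0 := ediv_le_of_lt' hp0 0 (by linarith)
  have t23 : ((n : ℤ) * 60 - n * 24 - n * 22) / p ≤ 0 := ediv_le_of_lt' hp0 0 (by linarith)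
  have t24 : ((n : ℤ) * 60 - n * 24 - n * 21) / p ≤ 0 := ediv_le_of_lt' hp0 0 (by linarith)
  have t25 : ((n : ℤ) * 60 - n * 24 - n * 19) / p ≤ 0 := ediv_le_of_lt' hp0 0 (by linarith)
  have t26 : ((n : ℤ) * 60 - n * 24 - n * 18) / p ≤ 0 := ediv_le_of_lt' hp0 0 (by linarith)
  have t27 : ((n : ℤ) * 60 - n * 24 - n * 16) / p ≤ 0 := ediv_le_of_lt' hp0 0 (by linarith)
  have t34 : ((n : ℤ) * 60 - n * 22 - n * 21) / p ≤ 0 := ediv_le_of_lt' hp0 0 (by linarith)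
  have t35 : ((n : ℤ) * 60 - n * 22 - n * 19) / p ≤ 0 := ediv_le_of_lt' hp0 0 (by linarith)
  have t36 : ((n : ℤ) * 60 - n * 22 - n * 18) / p ≤ 0 := ediv_le_of_lt' hp0 0 (by linarith)
  have t37 : ((n : ℤ) * 60 - n * 22 - n * 16) / p ≤ 1 := ediv_le_of_lt' hp0 1 (by linarith)
  have t45 : ((n : ℤ) * 60 - n * 21 - n * 19) / p ≤ 0 := ediv_le_of_lt' hp0 0 (by linarith)
  have t46 : ((n : ℤ) * 60 - n * 21 - n * 18) / p ≤ 0 := ediv_le_of_lt' hp0 0 (by linarith)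
  have t47 : ((n : ℤ) * 60 - n * 21 - n * 16) / p ≤ 1 := ediv_le_of_lt' hp0 1 (by linarith)
  have t56 : ((n : ℤ) * 60 - n * 19 - n * 18) / p ≤ 1 := ediv_le_of_lt' hp0 1 (by linarith)
  have t57 : ((n : ℤ) * 60 - n * 19 - n * 16) / p ≤ 1 := ediv_le_of_lt' hp0 1 (by linarith)
  have t67 : ((n : ℤ) * 60 - n * 18 - n * 16) / p ≤ 1 := ediv_le_of_lt' hp0 1 (by linarith)
  linarith

/-- **W7 for `b`: `v_p(W(n·β)) ≥ 0` on the band** (`n ≥ 1`, `21n < p ≤ 22n`, `W ≠ 0`), by the window W-law with `law_W ≥ 1 + 4 − 5`. -/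
theorem w7_val {n p : ℕ} (_hn : 1 ≤ n) (hp : p.Prime) (hA : 21 * n < p) (hB : p ≤ 22 * n)
    (hW : coeffW ((bRay [60, 25, 24, 22, 21, 19, 18, 16]) n) ≠ 0) : 0 ≤ padicValRat p (coeffW ((bRay [60, 25, 24, 22, 21, 19, 18, 16]) n)) := by
  obtain ⟨hp5, -, -, hwin⟩ := window (n := n) (p := p) hA (by omega)
  have hlaw := zeta3CoefficientValuationLaw_window ((bRay [60, 25, 24, 22, 21, 19, 18, 16]) n) p (inPolytope_ray n) hp hp5 hwin hW
  have h1 := refundW_flag (n := n) hp.pos (by omega)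
  have h2 := topPartners_flag_ge (n := n) hB
  have h3 := pairFloors_flag_le (n := n) hp.pos hA
  unfold lawW at hlaw
  linarith

/-! ## §2 The shifted vector `b + e₇ = (60n; 25n, 24n, 22n, 21n, 19n, 18n, 16n + 1)` -/

/-- Components of the shift. -/
theorem shift7_apply (n i : ℕ) : shift ((bRay [60, 25, 24, 22, 21, 19, 18, 16]) n) 7 i = if i = 7 then (bRay [60, 25, 24, 22, 21, 19, 18, 16]) n 7 + 1 else (bRay [60, 25, 24, 22, 21, 19, 18, 16]) n i := by
  simp only [shift, Function.update_apply]

/-- `bMin (b + e₇) = 16n + 1` (`n ≥ 1`). -/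
theorem bMin_flag_shift {n : ℕ} (hn : 1 ≤ n) : bMin (shift ((bRay [60, 25, 24, 22, 21, 19, 18, 16]) n) 7) = ((n * 16 : ℕ) : ℤ) + 1 := by
  unfold bMin
  apply le_antisymm
  · exact Finset.min'_le _ _ (mem_image.2 ⟨6, by simp, by rw [shift7_apply]; simp [v7]⟩)
  · apply Finset.le_min'
    intro x hx
    obtain ⟨i, hi, rfl⟩ := mem_image.1 hx
    have : i < 7 := mem_range.1 hi
    interval_cases i <;>
      simp only [Nat.reduceAdd, shift7_apply, Nat.reduceEqDiff, if_true, if_false, v1, v2, v3, v4, v5, v6, v7] <;>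
      push_cast <;> omega

/-- `d(b + e₇) = 35n − 1`, so the refund is `1` for `p ≤ 35n`. -/
theorem refundW_flag_shift {n p : ℕ} (hp0 : 0 < p) (h : p ≤ 35 * n) : refundW (shift ((bRay [60, 25, 24, 22, 21, 19, 18, 16]) n) 7) p = 1 := by
  unfold refundW
  rw [BigPrime.dOf_shift _ (by norm_num) (by norm_num), dOf_ray]
  apply min_eq_left
  rw [Int.le_ediv_iff_mul_le (by exact_mod_cast hp0)]
  push_cast
  have : (p : ℤ) ≤ 35 * n := by exact_mod_cast h
  linarith

/-- `a_p(b + e₇) ≥ 4` on the band: the partners `22n−1, 23n−1, 25n−1, 26n−1` (and `28n−2`) reach `p ≤ 22n − 1` (`22n` is not prime). -/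
theorem topPartners_flag_shift_ge {n p : ℕ} (hn : 1 ≤ n) (hB : p + 1 ≤ 22 * n) : 4 ≤ topPartners (shift ((bRay [60, 25, 24, 22, 21, 19, 18, 16]) n) 7) p := by
  unfold topPartners
  rw [bMin_flag_shift hn]
  have hsub : ({2, 3, 4, 5, 6} : Finset ℕ) ⊆
      (range 7).filter (fun i => (p : ℤ) ≤ shift ((bRay [60, 25, 24, 22, 21, 19, 18, 16]) n) 7 0 - shift ((bRay [60, 25, 24, 22, 21, 19, 18, 16]) n) 7 (i + 1) - (((n * 16 : ℕ) : ℤ) + 1)) := by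
    intro i hi
    simp only [mem_insert, mem_singleton] at hi
    rw [mem_filter, mem_range]
    have hp : (p : ℤ) + 1 ≤ 22 * n := by exact_mod_cast hB
    rcases hi with rfl | rfl | rfl | rfl | rfl <;> refine ⟨by norm_num, ?_⟩ <;>
      simp only [Nat.reduceAdd, shift7_apply, Nat.reduceEqDiff, if_true, if_false, v0, v3, v4, v5, v6, v7] <;> push_cast <;> linarith
  have hc := Finset.card_le_card hsub
  have h5 : ({2, 3, 4, 5, 6} : Finset ℕ).card = 5 := by decide
  have : (if (p : ℤ) ≤ shift ((bRay [60, 25, 24, 22, 21, 19, 18, 16]) n) 7 0 - 2 * (((n * 16 : ℕ) : ℤ) + 1) then (1 : ℤ) else 0) ≤ 1 := by split_ifs <;> norm_num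
  omega

/-- **W7 for `b + e₇`: `v_p(W(n·β + e₇)) ≥ 0` on the band** (`n ≥ 1`, `21n < p ≤ 22n`, `W ≠ 0`). -/
theorem w7_shift_val {n p : ℕ} (hn : 1 ≤ n) (hp : p.Prime) (hA : 21 * n < p) (hB : p ≤ 22 * n)
    (hW : coeffW (shift ((bRay [60, 25, 24, 22, 21, 19, 18, 16]) n) 7) ≠ 0) : 0 ≤ padicValRat p (coeffW (shift ((bRay [60, 25, 24, 22, 21, 19, 18, 16]) n) 7)) := by
  obtain ⟨hp5, -, -, hwin⟩ := window (n := n) (p := p) hA (by omega)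
  have hwin' : (shift ((bRay [60, 25, 24, 22, 21, 19, 18, 16]) n) 7 0 + 2 : ℤ) < (p : ℤ) ^ 2 := by rw [BigPrime.shift_zero _ (by norm_num)]; exact hwin
  have hlaw := zeta3CoefficientValuationLaw_window (shift ((bRay [60, 25, 24, 22, 21, 19, 18, 16]) n) 7) p (inPolytope_shift_ray hn) hp hp5 hwin' hW
  -- `p = 22n` is impossible for a prime (`n ≥ 1`): `22n = 2·(11n)`
  have hB' : p + 1 ≤ 22 * n := by
    rcases Nat.lt_or_ge p (22 * n) with h | h
    · omega
    · exfalso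
      have he : p = 22 * n := le_antisymm hB h
      have h2 : 2 ∣ p := ⟨11 * n, by omega⟩
      have := (Nat.prime_dvd_prime_iff_eq Nat.prime_two hp).1 h2
      omega
  have h1 := refundW_flag_shift (n := n) hp.pos (by omega)
  have h2 := topPartners_flag_shift_ge (n := n) hn hB'
  have h3 : pairFloors (shift ((bRay [60, 25, 24, 22, 21, 19, 18, 16]) n) 7) p ≤ 5 :=
    (pairFloors_shift_le ((bRay [60, 25, 24, 22, 21, 19, 18, 16]) n) (by norm_num) p hp.pos).trans (pairFloors_flag_le (n := n) hp.pos hA)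
  unfold lawW at hlaw
  linarith

/-! ## §3 Norm form (the shape of theory-d1 g2's `FlagBandW7`) -/

/-- **W7 (flag band W-law, norm form): `‖W(n·β)‖_p ≤ 1` and `‖W(n·β + e₇)‖_p ≤ 1` for every `n ≥ 1` and every prime `21n < p ≤ 22n`.** -/
theorem w7_norm (n p : ℕ) (hn : 1 ≤ n) (hp : p.Prime) (hA : 21 * n < p) (hB : p ≤ 22 * n) :
    padicNorm p (coeffW ((bRay [60, 25, 24, 22, 21, 19, 18, 16]) n)) ≤ 1 ∧ padicNorm p (coeffW (shift ((bRay [60, 25, 24, 22, 21, 19, 18, 16]) n) 7)) ≤ 1 := by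
  haveI : Fact p.Prime := ⟨hp⟩
  constructor
  · have h := padicNorm_le_of_val (p := p) (x := coeffW ((bRay [60, 25, 24, 22, 21, 19, 18, 16]) n)) (m := 0) (fun hne => w7_val hn hp hA hB hne)
    simpa using h
  · have h := padicNorm_le_of_val (p := p) (x := coeffW (shift ((bRay [60, 25, 24, 22, 21, 19, 18, 16]) n) 7)) (m := 0) (fun hne => w7_shift_val hn hp hA hB hne)
    simpa using h

end Summit.KontsevichZagierPeriods.Zeta5Search.StairFLAG
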